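import Summits.HodgeConjecture.HodgeConjecture.Theorems.F0P2aStubDensity
import Summits.HodgeConjecture.HodgeConjecture.Theorems.F0P2aCohFormsContinuous
import HarnessLib

/-!
# F0-P2a · line 2 (B4-ARCHIMEDEAN DESK), stub S2β CLOSED BY NAME: `stub_density_holds : ⟨DensityType⟩`

Cell hodgecm-mathlib, FLOOR 0; crux item H413 = stmt-HodgeConjecture-24833 (route `HCCMUnconditional`); line
`Cruxes/H413/Lines/F0_P2aCohIsotypicLine.lean` (F0P2a-plan (g2), sha16 fe64be0a9875628f), registered stub `stub_density : DensityType`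
(:174 / :221).  Seat F0P2a-p05 (g0).  THEOREMS ONLY; no `sorry`; no named-fact hypothesis.

The content is ★ `Theorems/F0P2aStubDensity.lean` (p795563: `densityType_of_continuous` — the closed invariant subspace
`{v ∈ P ∣ ∀ x, ⟪R(x) v, [Φ₃]ⱼ'⟫ = 0}` of the irreducible `P` contains the classes of `N` by the frame's product decomposition
`x = cmArchSection u · k · (1, g)`, right `K_c`-invariance and `G_f`-stability, hence is `P`; continuity + `μ` positive on opens) and the desk
support B5 ★ `Theorems/F0P2aCohFormsContinuous.lean` (F0P2a-p03, p796556, `continuous_of_mem_cohForms_frame`: the cohomological cotangent forms of the CM frame are continuous on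
`U(H)(𝔸_{L⁺})`).  This file is the one-line application; its TYPE is the body of the line's `def DensityType` with the line's reducible
abbreviations `𝒰 / Gf / Rf / coh` unfolded (the `Lines/` file is not importable), so `stub_density := F0P2aStubDensityHolds.stub_density_holds`
elaborates by `δ`-unfolding.  HONEST LABEL: HC_CM is proved only modulo the 7 printed citations until rung 0 closes; this file discharges none of them.

## References
* [BorelJacquet1979] A. Borel, H. Jacquet, *Automorphic forms and automorphic representations*, PSPM 33.1 (1979), §4.1, §4.6.
* [GelfandGraevPiatetskiShapiro1969] I. M. Gelfand, M. I. Graev, I. I. Piatetski-Shapiro, *Representation theory and automorphic functions* (1969),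
  Ch. 1 §2.3.
* Tree: ★ `Theorems/F0P2aStubDensity` (the proof), ★ `Theorems/F0P2aCohFormsContinuous` (B5).
-/

set_option autoImplicit false

-- the mandated namespace has the single-problem summit's repeated segment (`HodgeConjecture.HodgeConjecture`)
set_option linter.dupNamespace false

noncomputable section

namespace Summit.HodgeConjecture.HodgeConjecture.Cruxes.H413.F0P2aStubDensityHolds

open MeasureTheory NumberField
open scoped InnerProductSpace ENNReal ComplexOrder Matrix
open Literature.NumberTheory.Automorphic Literature.NumberTheory.Automorphic.UnitaryGroup
open Literature.NumberTheory.Automorphic.UnitaryGroup.CotangentForms (toQuotFun cmArchSection cmCompactFactor)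

/-- **STUB S2β OF THE LINE, BY NAME — density / irreducibility.**  For the CM datum `(L, ι, H, T, hT)` (`H` of signature `(2,1)` at `ι`
through the frame `T`, definite at the other places, `[L⁺:ℚ] ≥ 2`), an automorphic measure `μ`, a discrete automorphic `P`, a non-zero
`U(H)(𝔸_{L⁺,f})`-stable space `N` of cohomological cotangent forms contained in `P`, and a cohomological cotangent form `Φ₃` contained in `P`
whose coordinate classes are orthogonal to every archimedean translate of every coordinate class of `N`: `Φ₃ = 0` (the classes of `Φ₃` are
orthogonal to the closed `U(H)(𝔸)`-span of the classes of `N`, which is all of the topologically irreducible `P`; continuity of cohomological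
forms and positivity of `μ` on open sets).  Type = the body of `F0P2aCohIsotypicLine.DensityType`. [cite: BorelJacquet1979, §4.6]
[cite: GelfandGraevPiatetskiShapiro1969, Ch. 1 §2.3] -/
theorem stub_density_holds :
    ∀ (L : Type) [Field L] [NumberField L] [IsCMField L] (ι : L →+* ℂ) (H : Matrix (Fin 3) (Fin 3) L) (T : GL (Fin 3) ℂ)
      (hT : (T : Matrix (Fin 3) (Fin 3) ℂ)ᴴ * H.map ι * (T : Matrix (Fin 3) (Fin 3) ℂ) = Literature.Geometry.ComplexHyperbolic.BallModel.J),
      (∀ τ' : L →+* ℂ, InfinitePlace.mk τ' ≠ InfinitePlace.mk ι → (H.map τ').PosDef) →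
      2 ≤ Module.finrank ℚ ↥(maximalRealSubfield L) →
      ∀ (μ : Measure (adelicGroupData (↥(maximalRealSubfield L)) L (IsCMField.complexConj L) 3 H).automorphicQuotient)
        [(adelicGroupData (↥(maximalRealSubfield L)) L (IsCMField.complexConj L) 3 H).IsAutomorphicMeasure μ]
        (P : DiscreteAutomorphicRep (adelicGroupData (↥(maximalRealSubfield L)) L (IsCMField.complexConj L) 3 H) μ)
        (N : Submodule ℂ ((adelicGroupData (↥(maximalRealSubfield L)) L (IsCMField.complexConj L) 3 H).Adelic → (Fin 2 → ℂ))),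
        N ≤ CotangentForms.cohForms (↥(maximalRealSubfield L)) L (IsCMField.complexConj L) 3 H (cmArchSection L ι H T hT)
          (cmCompactFactor L ι H T hT) →
      (∀ Φ ∈ N, P.ContainsForm Φ) →
      (∀ (g : finAdelic (↥(maximalRealSubfield L)) L (IsCMField.complexConj L) 3 H), ∀ Φ ∈ N,
        CotangentForms.rightRep (↥(maximalRealSubfield L)) L (IsCMField.complexConj L) 3 H g Φ ∈ N) → N ≠ ⊥ →
      ∀ Φ₃ ∈ CotangentForms.cohForms (↥(maximalRealSubfield L)) L (IsCMField.complexConj L) 3 H (cmArchSection L ι H T hT)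
        (cmCompactFactor L ι H T hT), P.ContainsForm Φ₃ →
      (∀ Φ ∈ N, ∀ (hΦ : ∀ j : Fin 2, MemLp (toQuotFun (adelicGroupData (↥(maximalRealSubfield L)) L (IsCMField.complexConj L) 3 H)
            fun x => Φ x j) 2 μ)
          (h₃ : ∀ j : Fin 2, MemLp (toQuotFun (adelicGroupData (↥(maximalRealSubfield L)) L (IsCMField.complexConj L) 3 H)
            fun x => Φ₃ x j) 2 μ),
        ∀ (u : Literature.Geometry.ComplexHyperbolic.BallModel.U21) (j j' : Fin 2),
          ⟪(adelicGroupData (↥(maximalRealSubfield L)) L (IsCMField.complexConj L) 3 H).rightRegular μ (cmArchSection L ι H T hT u)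
              ((hΦ j).toLp (toQuotFun (adelicGroupData (↥(maximalRealSubfield L)) L (IsCMField.complexConj L) 3 H) fun x => Φ x j)),
            (h₃ j').toLp (toQuotFun (adelicGroupData (↥(maximalRealSubfield L)) L (IsCMField.complexConj L) 3 H)
              fun x => Φ₃ x j')⟫_ℂ = 0) →
      Φ₃ = 0 :=
  F0P2aStubDensity.densityType_of_continuous F0P2aCohFormsContinuous.continuous_of_mem_cohForms_frame

end Summit.HodgeConjecture.HodgeConjecture.Cruxes.H413.F0P2aStubDensityHolds

end
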